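import Literature.Geometry.Riemannian.MetricFlowPhiDensity
import Mathlib.Analysis.SpecialFunctions.Log.Basic
import HarnessLib

/-!
# Gaussian Mills-ratio bound for Bamler's profile `F = Φ' ∘ Φ⁻¹` (Bamler 2020a, (4.12))

R. Bamler, *Entropy and heat kernel bounds on a Ricci flow background*, arXiv:2008.07093, §4.3,
display (4.12): the comparison profile `F(a) := Φ'(Φ⁻¹(a))` of the sharp gradient bound
(Prop. 4.2), where `Φ` is the distribution function of the centred Gaussian of variance `2`
(`MetricFlow.Phi`, density `Φ'(x) = (4π)^{-1/2} e^{-x²/4}`) and `Φ⁻¹ : (0, 1) → ℝ` its inverse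
(`MetricFlow.PhiInv`), satisfies `F(a) ≤ C a (−log a)^{1/2}` for small `a`. This is the classical
two-sided Gaussian tail (Mills-ratio) estimate. This file proves it in the global form on `(0, 1)`
consumed downstream:

* `Phi_le_exp_neg_sq_div_four` — the upper tail bound `Φ(s) ≤ e^{-s²/4}` for `s < -2`;
* `deriv_Phi_le_neg_mul_Phi` — the lower Mills bound `Φ'(s) ≤ |s| Φ(s)` for `s < -2`;
* `exists_deriv_Phi_PhiInv_le_mul_sqrt_one_sub_log` — **(4.12)**: there is `C₁ > 0` with
  `Φ'(Φ⁻¹ b) ≤ C₁ b √(1 − log b)` for all `b ∈ (0, 1)`.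

Both tail bounds are proved by the same device: a function that is monotone on `(-∞, a)` (sign of
an explicit derivative) and tends to `0` at `-∞` is nonnegative there
(`nonneg_of_monotoneOn_Iio_of_tendsto_atBot`). Everything is proved; no definitions, no named
facts.

## References

* R. H. Bamler, *Entropy and heat kernel bounds on a Ricci flow background*, arXiv:2008.07093
  (2020), §4.3, (4.12). [Bamler2020Entropy]
-/

noncomputable section

open Set Filter
open scoped Topology

namespace Literature.Geometry.Riemannian

namespace MetricFlow

/-! ### A monotonicity device -/

/-- A function that is monotone on `(-∞, a)` and tends to `0` at `-∞` is nonnegative on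
`(-∞, a)`. [folklore] -/
theorem nonneg_of_monotoneOn_Iio_of_tendsto_atBot {f : ℝ → ℝ} {a u : ℝ}
    (hf : MonotoneOn f (Iio a)) (h0 : Tendsto f atBot (𝓝 0)) (hu : u < a) : 0 ≤ f u := by
  refine le_of_tendsto h0 ?_
  filter_upwards [eventually_le_atBot u] with v hv
  exact hf (mem_Iio.2 (lt_of_le_of_lt hv hu)) (mem_Iio.2 hu) hv

/-- A function with nonnegative derivative on `(-∞, a)` is monotone there. [folklore] -/
theorem monotoneOn_Iio_of_hasDerivAt_nonneg {f f' : ℝ → ℝ} {a : ℝ}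
    (hf : ∀ x < a, HasDerivAt f (f' x) x) (hf' : ∀ x < a, 0 ≤ f' x) : MonotoneOn f (Iio a) := by
  refine monotoneOn_of_hasDerivWithinAt_nonneg (f' := f') (convex_Iio a)
    (fun x hx ↦ (hf x hx).continuousAt.continuousWithinAt) ?_ ?_
  · rw [interior_Iio]
    exact fun x hx ↦ (hf x hx).hasDerivWithinAt
  · rw [interior_Iio]
    exact hf'

/-! ### Gaussian tail bounds -/

/-- `(4π)^{-1/2} ≤ 1`. [folklore] -/
theorem inv_sqrt_four_pi_le_one : (Real.sqrt (4 * Real.pi))⁻¹ ≤ 1 := by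
  refine inv_le_one_of_one_le₀ (Real.one_le_sqrt.2 ?_)
  have := Real.two_le_pi
  linarith

/-- `e^{-u²/4} → 0` as `u → -∞`. [folklore] -/
theorem tendsto_exp_neg_sq_div_four_atBot :
    Tendsto (fun u : ℝ ↦ Real.exp (-u ^ 2 / 4)) atBot (𝓝 0) := by
  have hne : Real.sqrt (4 * Real.pi) ≠ 0 := (Real.sqrt_pos.2 (by positivity)).ne'
  have h := tendsto_deriv_Phi_atBot.const_mul (Real.sqrt (4 * Real.pi))
  rw [mul_zero] at h
  refine h.congr (fun u ↦ ?_)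
  rw [deriv_Phi, ← mul_assoc, mul_inv_cancel₀ hne, one_mul]

/-- **Upper Gaussian tail bound**: `Φ(s) ≤ e^{-s²/4}` for `s < -2` (the function
`e^{-u²/4} − Φ(u)` has derivative `e^{-u²/4}(−u/2 − (4π)^{-1/2}) ≥ 0` on `(-∞, -2)` and tends
to `0` at `-∞`). [cite: Bamler2020Entropy, §4.3, (4.12)] -/
theorem Phi_le_exp_neg_sq_div_four {s : ℝ} (hs : s < -2) : Phi s ≤ Real.exp (-s ^ 2 / 4) := by
  have hG : ∀ u : ℝ, HasDerivAt (fun u ↦ Real.exp (-u ^ 2 / 4) - Phi u)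
      (Real.exp (-u ^ 2 / 4) * (-(2 * u) / 4) -
        (Real.sqrt (4 * Real.pi))⁻¹ * Real.exp (-u ^ 2 / 4)) u := by
    intro u
    have h1 : HasDerivAt (fun x : ℝ ↦ -x ^ 2 / 4) (-(2 * u) / 4) u := by
      simpa using ((hasDerivAt_pow 2 u).neg).div_const 4
    exact h1.exp.sub (hasDerivAt_Phi u)
  have hmono : MonotoneOn (fun u ↦ Real.exp (-u ^ 2 / 4) - Phi u) (Iio (-2)) := by
    refine monotoneOn_Iio_of_hasDerivAt_nonneg (fun u _ ↦ hG u) (fun u hu ↦ ?_)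
    have hc := inv_sqrt_four_pi_le_one
    have e : Real.exp (-u ^ 2 / 4) * (-(2 * u) / 4) -
        (Real.sqrt (4 * Real.pi))⁻¹ * Real.exp (-u ^ 2 / 4) =
        Real.exp (-u ^ 2 / 4) * (-u / 2 - (Real.sqrt (4 * Real.pi))⁻¹) := by ring
    rw [e]
    exact mul_nonneg (Real.exp_pos _).le (by linarith)
  have hlim : Tendsto (fun u ↦ Real.exp (-u ^ 2 / 4) - Phi u) atBot (𝓝 0) := by
    simpa using tendsto_exp_neg_sq_div_four_atBot.sub tendsto_Phi_atBot
  have h := nonneg_of_monotoneOn_Iio_of_tendsto_atBot hmono hlim hs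
  linarith

/-- **Lower Mills-ratio bound**: `Φ'(s) ≤ |s| Φ(s)` for `s < -2` (the function
`Φ(u) + Φ'(u)/u` has derivative `Φ'(u)(1/2 − 1/u²) ≥ 0` on `(-∞, -2)`, using `Φ'' = −(u/2)Φ'`,
and tends to `0` at `-∞`). [cite: Bamler2020Entropy, §4.3, (4.12)] -/
theorem deriv_Phi_le_neg_mul_Phi {s : ℝ} (hs : s < -2) : deriv Phi s ≤ -s * Phi s := by
  have hD : ∀ u < (-2 : ℝ), HasDerivAt (fun u ↦ Phi u + deriv Phi u / u)
      (deriv Phi u + ((-(u / 2) * deriv Phi u) * u - deriv Phi u * 1) / u ^ 2) u := by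
    intro u hu
    have hu0 : u ≠ 0 := by
      intro h
      rw [h] at hu
      linarith
    exact (hasDerivAt_Phi_deriv u).add ((hasDerivAt_deriv_Phi u).div (hasDerivAt_id' u) hu0)
  have hmono : MonotoneOn (fun u ↦ Phi u + deriv Phi u / u) (Iio (-2)) := by
    refine monotoneOn_Iio_of_hasDerivAt_nonneg hD (fun u hu ↦ ?_)
    have hu0 : u ≠ 0 := by
      intro h
      rw [h] at hu
      linarith
    have hp := deriv_Phi_pos u
    have e : deriv Phi u + ((-(u / 2) * deriv Phi u) * u - deriv Phi u * 1) / u ^ 2 =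
        deriv Phi u * (u ^ 2 - 2) / (2 * u ^ 2) := by
      field_simp
      ring
    rw [e]
    refine div_nonneg (mul_nonneg hp.le ?_) (by positivity)
    nlinarith
  have hlim : Tendsto (fun u ↦ Phi u + deriv Phi u / u) atBot (𝓝 0) := by
    simpa using tendsto_Phi_atBot.add (tendsto_deriv_Phi_atBot.div_atBot tendsto_id)
  have h := nonneg_of_monotoneOn_Iio_of_tendsto_atBot hmono hlim hs
  have hs0 : s < 0 := by linarith
  have h' : -Phi s ≤ deriv Phi s / s := by
    have : (0 : ℝ) ≤ Phi s + deriv Phi s / s := h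
    linarith
  rw [le_div_iff_of_neg hs0] at h'
  linarith

/-! ### Bamler's (4.12) -/

/-- **Bamler 2020a, (4.12)**: the profile `F = Φ' ∘ Φ⁻¹` satisfies
`F(b) ≤ C₁ b √(1 − log b)` on all of `(0, 1)` for some `C₁ > 0` (for `Φ⁻¹ b < -2` combine the
Mills bound `Φ'(s) ≤ |s| Φ(s)` with `|s| ≤ 2 √(−log Φ(s))` from `Φ(s) ≤ e^{-s²/4}`; for
`Φ⁻¹ b ≥ -2` use `b ≥ Φ(-2)` and `F ≤ (4π)^{-1/2} ≤ 1`). [cite: Bamler2020Entropy, §4.3, (4.12)] -/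
theorem exists_deriv_Phi_PhiInv_le_mul_sqrt_one_sub_log :
    ∃ C₁ : ℝ, 0 < C₁ ∧ ∀ b ∈ Ioo (0 : ℝ) 1,
      deriv Phi (PhiInv b) ≤ C₁ * b * Real.sqrt (1 - Real.log b) := by
  have hb₀ : 0 < Phi (-2) := Phi_pos _
  have hb₀1 : Phi (-2) < 1 := Phi_lt_one _
  refine ⟨2 / Phi (-2), by positivity, fun b hb ↦ ?_⟩
  obtain ⟨hb0, hb1⟩ := hb
  have hbs : Phi (PhiInv b) = b := Phi_PhiInv hb0 hb1
  have hlog : Real.log b ≤ 0 := Real.log_nonpos hb0.le hb1.le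
  have hsqrt1 : 1 ≤ Real.sqrt (1 - Real.log b) := Real.one_le_sqrt.2 (by linarith)
  have hsqrt0 : 0 ≤ Real.sqrt (1 - Real.log b) := Real.sqrt_nonneg _
  have hC2 : 2 ≤ 2 / Phi (-2) := by
    rw [le_div_iff₀ hb₀]
    nlinarith
  rcases le_or_gt (-2) (PhiInv b) with hs | hs
  · -- `Φ⁻¹ b ≥ -2`: `b ≥ Φ(-2)` and `F(b) ≤ (4π)^{-1/2} ≤ 1`.
    have hb_ge : Phi (-2) ≤ b := hbs ▸ Phi_mono hs
    have h1 : deriv Phi (PhiInv b) ≤ 1 := (deriv_Phi_le _).trans inv_sqrt_four_pi_le_one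
    calc deriv Phi (PhiInv b) ≤ 1 := h1
      _ ≤ 2 / Phi (-2) * b := by
        rw [div_mul_eq_mul_div, le_div_iff₀ hb₀]
        linarith
      _ ≤ 2 / Phi (-2) * b * Real.sqrt (1 - Real.log b) :=
        le_mul_of_one_le_right (by positivity) hsqrt1
  · -- `Φ⁻¹ b < -2`: Mills bound and the upper tail bound.
    have h1 : deriv Phi (PhiInv b) ≤ -PhiInv b * b := by
      have := deriv_Phi_le_neg_mul_Phi hs
      rwa [hbs] at this
    have h2 : b ≤ Real.exp (-PhiInv b ^ 2 / 4) := by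
      have := Phi_le_exp_neg_sq_div_four hs
      rwa [hbs] at this
    have h3 : Real.log b ≤ -PhiInv b ^ 2 / 4 := (Real.log_le_iff_le_exp hb0).2 h2
    have h4 : -PhiInv b / 2 ≤ Real.sqrt (1 - Real.log b) := by
      rw [Real.le_sqrt (by linarith) (by linarith)]
      nlinarith
    calc deriv Phi (PhiInv b) ≤ -PhiInv b * b := h1
      _ = 2 * b * (-PhiInv b / 2) := by ring
      _ ≤ 2 * b * Real.sqrt (1 - Real.log b) :=
        mul_le_mul_of_nonneg_left h4 (by positivity)
      _ ≤ 2 / Phi (-2) * b * Real.sqrt (1 - Real.log b) :=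
        mul_le_mul_of_nonneg_right (mul_le_mul_of_nonneg_right hC2 hb0.le) hsqrt0

end MetricFlow

end Literature.Geometry.Riemannian

end
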